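import Literature.Analysis.FluidPDE.CarlemanSecond
import HarnessLib

/-!
# The anisotropic Carleman weight adapted to a cone (Li–Šverák 2012, Prop. 2.3): calculus

Analysis/FluidPDE support file (real definitions and proved theorems only; no named facts) for
the proof of Li–Šverák's backward-uniqueness theorem in cones
(`Literature.Analysis.FluidPDE.coneBackwardUniquenessC12`, file `ConeBackwardUniqueness`).
The new Carleman inequality of that paper (Prop. 2.3, proved in §4) conjugates the backward heat
operator by `e^φ` with the weight

  `φ(x, t) = a Λ(t) φ₀(x) + t²`, `φ₀(x) = x₁^α - ε^α |x|^α`, `1 < α < 2`, `ε = cos(θ/2)`,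

on the truncated cone `Q_θ = (𝒪_θ ∩ {x₁ > 1}) × ]0, 1[`, `𝒪_θ = {x₁ > ε|x|}` (the paper takes
`Λ(t) = (1 - t) t^{-α/2}`). This file provides the weight in the tree's frame vocabulary
(`CarlemanCalculus`: `dt`, `dx`, `lap`, `gradSq`; `CarlemanCalculusOpen`: `gradX`) for a
finite-dimensional real inner product space `E`, an axis `e` (`x₁ = ⟪x, e⟫`), the exponent
written `α = 2β` and the coefficient `ε^α` kept as a free parameter `η`:

* `radPow q z = (‖x‖²)^q` and its calculus on `{x ≠ 0}` (gradient, Hessian, Laplacian,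
  bi-Laplacian of `f(t) (‖x‖²)^q`);
* `conePhi0 β η e x = ⟪x, e⟫^{2β} - η (‖x‖²)^β` (`= x₁^α - ε^α|x|^α`), `coneGrad` its gradient,
  and `conePhi a β η e z = t² + a k₁(t) conePhi0 β η e x` with the RATIONAL time profile
  `k₁(t) = (1 - t)/t = kA 1 t` (Li–Šverák's profile for `α = 2`; on the supports used in the
  proof of Lemma 2.4, `t ∈ ]1/2, 1[`, any decreasing profile vanishing at `t = 1` with
  `t k₁'' + k₁' > 0` does, and this one keeps the time calculus polynomial);
* all the derivative fields of `conePhi` entering the commutator identity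
  `Carleman.two_mul_integral_inner_opSW_opAW_printed` (Seregin 2014, (A.1.6)): `dx`, `dt`,
  `gradX`, the frame Hessian `∂ᵢ∂ⱼφ`, `Δφ`, `Δ²φ`, `∂ₜ²φ`, `∂ₜ|∇φ|²`, and the two contractions
  `Σᵢⱼ φᵢⱼ ⟪∂ⱼv, ∂ᵢv⟫`, `Σᵢⱼ φᵢⱼ φᵢ φⱼ` (paper, (4.5)–(4.9)).

All statements are proved. The Carleman inequality itself is `ConeCarlemanSecond`.

## References

* L. Li, V. Šverák, *Backward uniqueness for the heat equation in cones*, Comm. PDE 37 (2012)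
  1414–1429, arXiv:1011.2796, Prop. 2.3 and §4. [LiSverak2012]
* G. Seregin, *Lecture notes on regularity theory for the Navier–Stokes equations*, World
  Scientific 2014, App. A.1 (the `L₂` Carleman method). [Seregin2014]
-/

noncomputable section

open MeasureTheory Set Function Filter
open _root_.Topology
open scoped InnerProductSpace RealInnerProductSpace

namespace Literature.Analysis.FluidPDE

namespace Carleman

section ConeWeight

variable {E : Type*} [NormedAddCommGroup E] [InnerProductSpace ℝ E]
variable {F : Type*} [NormedAddCommGroup F] [InnerProductSpace ℝ F]

/-! ### Radial powers `(‖x‖²)^q` -/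

/-- The radial power `(t, x) ↦ (‖x‖²)^q` (`= |x|^{2q}` for `x ≠ 0`). [folklore] -/
def radPow (q : ℝ) (z : ℝ × E) : ℝ := (‖z.2‖ ^ 2) ^ q

omit [InnerProductSpace ℝ E] in
/-- Unfolding `radPow`. [folklore] -/
@[simp] theorem radPow_apply (q : ℝ) (z : ℝ × E) : radPow q z = (‖z.2‖ ^ 2) ^ q := rfl

omit [InnerProductSpace ℝ E] in
/-- `radPow q > 0` for `x ≠ 0`. [folklore] -/
theorem radPow_pos (q : ℝ) {z : ℝ × E} (hz : z.2 ≠ 0) : 0 < radPow q z :=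
  Real.rpow_pos_of_pos (by positivity) _

omit [InnerProductSpace ℝ E] in
/-- `(‖x‖²)^{q-1} ‖x‖² = (‖x‖²)^q` for `x ≠ 0`. [folklore] -/
theorem radPow_sub_one_mul (q : ℝ) {z : ℝ × E} (hz : z.2 ≠ 0) :
    radPow (q - 1) z * ‖z.2‖ ^ 2 = radPow q z := by
  have hR : (‖z.2‖ ^ 2 : ℝ) ≠ 0 := by positivity
  rw [radPow_apply, radPow_apply, Real.rpow_sub_one hR, div_mul_cancel₀ _ hR]

/-- `(‖x‖²)^q` is smooth on `{x ≠ 0}`. [folklore] -/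
theorem contDiffOn_radPow (q : ℝ) :
    ContDiffOn ℝ (⊤ : ℕ∞) (radPow q : ℝ × E → ℝ) {z | z.2 ≠ 0} := by
  refine (contDiff_norm_sq_snd.contDiffOn).rpow_const_of_ne fun z hz => ?_
  have : z.2 ≠ 0 := hz
  positivity

/-- **Gradient of a radial power**: `(‖x‖²)^q` is differentiable at `x ≠ 0` with
`D[(‖x‖²)^q](z) v = 2q (‖x‖²)^{q-1} ⟪x, v.2⟫`. [folklore] -/
theorem hasFDerivAt_radPow (q : ℝ) {z : ℝ × E} (hz : z.2 ≠ 0) :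
    HasFDerivAt (radPow q : ℝ × E → ℝ)
      ((ContinuousLinearMap.toSpanSingleton ℝ (q * (‖z.2‖ ^ 2) ^ (q - 1))).comp
        (((2 : ℕ) • (innerSL ℝ (id z.2)).comp (ContinuousLinearMap.id ℝ E)).comp
          (ContinuousLinearMap.snd ℝ ℝ E))) z := by
  have hR : (‖z.2‖ ^ 2 : ℝ) ≠ 0 := by positivity
  have h1 := hasFDerivAt_norm_sq_snd z
  have h2 := Real.hasDerivAt_rpow_const (p := q) (x := ‖z.2‖ ^ 2) (Or.inl hR)
  exact h2.hasFDerivAt.comp z h1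

/-- `D[(‖x‖²)^q](z) v = 2q (‖x‖²)^{q-1} ⟪x, v.2⟫` for `x ≠ 0`. [folklore] -/
theorem fderiv_radPow_apply (q : ℝ) {z : ℝ × E} (hz : z.2 ≠ 0) (v : ℝ × E) :
    fderiv ℝ (radPow q : ℝ × E → ℝ) z v = 2 * q * (‖z.2‖ ^ 2) ^ (q - 1) * ⟪z.2, v.2⟫ := by
  rw [(hasFDerivAt_radPow q hz).fderiv]
  simp [innerSL_apply_apply]
  ring

/-- `(‖x‖²)^q` is differentiable at points with `x ≠ 0`. [folklore] -/
theorem differentiableAt_radPow (q : ℝ) {z : ℝ × E} (hz : z.2 ≠ 0) :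
    DifferentiableAt ℝ (radPow q : ℝ × E → ℝ) z :=
  (hasFDerivAt_radPow q hz).differentiableAt

/-- **`D[f(t) (‖x‖²)^q](z) v = f'(t) v.1 (‖x‖²)^q + f(t) 2q (‖x‖²)^{q-1} ⟪x, v.2⟫`** for `x ≠ 0`. [folklore] -/
theorem fderiv_sepRad_apply {f : ℝ → ℝ} (q : ℝ) {z : ℝ × E} (hf : DifferentiableAt ℝ f z.1)
    (hz : z.2 ≠ 0) (v : ℝ × E) :
    fderiv ℝ (fun y : ℝ × E => f y.1 * radPow q y) z v =
      deriv f z.1 * v.1 * radPow q z + f z.1 * (2 * q * (‖z.2‖ ^ 2) ^ (q - 1) * ⟪z.2, v.2⟫) := by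
  have h2 : DifferentiableAt ℝ (fun y : ℝ × E => f y.1) z := hf.comp z differentiableAt_fst
  rw [fderiv_fun_mul h2 (differentiableAt_radPow q hz)]
  simp only [_root_.add_apply, _root_.smul_apply, smul_eq_mul, fderiv_comp_fst_apply' hf,
    fderiv_radPow_apply q hz]
  ring

/-! ### The cone weight -/

/-- `φ₀(x) = ⟪x, e⟫^{2β} - η (‖x‖²)^β` — Li–Šverák's `x₁^α - ε^α|x|^α` with `α = 2β`,
`η = ε^α`. [cite: LiSverak2012, Prop. 2.3] -/
def conePhi0 (β η : ℝ) (e : E) (x : E) : ℝ := ⟪x, e⟫ ^ (2 * β) - η * (‖x‖ ^ 2) ^ β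

/-- `∇φ₀(x) = 2β ⟪x,e⟫^{2β-1} e - 2βη (‖x‖²)^{β-1} x` (`= α x₁^{α-1} e₁ - αε^α|x|^{α-2} x`). [cite: LiSverak2012, §4] -/
def coneGrad (β η : ℝ) (e : E) (x : E) : E :=
  (2 * β * ⟪x, e⟫ ^ (2 * β - 1)) • e - (2 * β * η * (‖x‖ ^ 2) ^ (β - 1)) • x

/-- **The cone Carleman weight** `φ(t, x) = t² + a k₁(t) φ₀(x)`, `k₁(t) = (1-t)/t = kA 1 t`
(Li–Šverák: `a Λ(t) φ₀(x) + t²`, `Λ(t) = (1-t)t^{-α/2}`; see the module docstring for the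
choice of the time profile). [cite: LiSverak2012, Prop. 2.3] -/
def conePhi (a β η : ℝ) (e : E) (z : ℝ × E) : ℝ := z.1 ^ 2 + a * kA 1 z.1 * conePhi0 β η e z.2

/-- On `Ω = halfDom e`, `x ≠ 0`. [folklore] -/
theorem snd_ne_zero_of_mem_halfDom {e : E} {z : ℝ × E} (hz : z ∈ halfDom e) : z.2 ≠ 0 := by
  intro h
  have h2 : (0 : ℝ) < ⟪z.2, e⟫ := hz.2
  rw [h, inner_zero_left] at h2
  exact lt_irrefl _ h2

/-- `halfDom e ⊆ {x ≠ 0}`. [folklore] -/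
theorem halfDom_subset_snd_ne_zero (e : E) : halfDom e ⊆ {z : ℝ × E | z.2 ≠ 0} :=
  fun _ hz => snd_ne_zero_of_mem_halfDom hz

/-! #### The time profile `k₁ = kA 1` -/

/-- `k₁(t) = (1 - t)/t` for `t > 0`. [folklore] -/
theorem kA_one_eq {t : ℝ} (ht : 0 < t) : kA 1 t = (1 - t) / t := by
  rw [kA_val ht, Real.rpow_neg_one, div_eq_mul_inv]

/-- `k₁'(t) = -1/t²` for `t > 0`. [folklore] -/
theorem deriv_kA_one {t : ℝ} (ht : 0 < t) : deriv (kA 1) t = -1 / t ^ 2 := by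
  rw [deriv_kA_val ht, Real.rpow_neg_one]
  field_simp
  ring

/-- `k₁''(t) = 2/t³` for `t > 0`. [folklore] -/
theorem deriv2_kA_one {t : ℝ} (ht : 0 < t) : deriv^[2] (kA 1) t = 2 / t ^ 3 := by
  rw [deriv2_kA_val ht, Real.rpow_neg_one]
  field_simp
  ring

/-- `k₁ ≥ 0` on `]0, 1]`. [folklore] -/
theorem kA_one_nonneg {t : ℝ} (ht : 0 < t) (ht1 : t ≤ 1) : 0 ≤ kA 1 t := by
  rw [kA_one_eq ht]
  exact div_nonneg (by linarith) ht.le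

/-! #### Smoothness on `Ω` -/

/-- The sep-rad building block `(−aη) k₁(t) (‖x‖²)^β` and the sep-add block
`t² + a k₁(t) ⟪x,e⟫^{2β}` sum to `φ`. [folklore] -/
theorem conePhi_eq (a β η : ℝ) (e : E) :
    conePhi a β η e = fun y : ℝ × E =>
      ((fun t : ℝ => t ^ 2) y.1 + (fun t => a * kA 1 t) y.1 * rhoA β ⟪y.2, e⟫) +
        (fun t => -(a * η) * kA 1 t) y.1 * radPow β y := by
  funext y
  simp only [conePhi, conePhi0, rhoA, radPow_apply]
  ring

/-- `φ ∈ C^∞(Ω)`. [folklore] -/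
theorem contDiffOn_conePhi (a β η : ℝ) (e : E) :
    ContDiffOn ℝ (⊤ : ℕ∞) (conePhi a β η e) (halfDom e) := by
  have hk : ContDiffOn ℝ (⊤ : ℕ∞) (fun y : ℝ × E => kA 1 y.1) (halfDom e) :=
    (contDiffOn_kA 1).comp contDiffOn_fst fun z hz => hz.1
  have hP : ContDiffOn ℝ (⊤ : ℕ∞) (fun y : ℝ × E => rhoA β ⟪y.2, e⟫) (halfDom e) :=
    (contDiffOn_rhoA β).comp (contDiff_inner_snd_const e).contDiffOn fun z hz => hz.2
  have hN : ContDiffOn ℝ (⊤ : ℕ∞) (radPow β : ℝ × E → ℝ) (halfDom e) :=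
    (contDiffOn_radPow β).mono (halfDom_subset_snd_ne_zero e)
  rw [conePhi_eq]
  exact ((contDiff_fst.pow 2).contDiffOn.add ((contDiffOn_const.mul hk).mul hP)).add
    ((contDiffOn_const.mul hk).mul hN)

/-! #### First derivatives -/

/-- **`Dφ(z) v`** on `Ω`:
`= 2t v.1 + a k₁'(t) v.1 φ₀(x) + a k₁(t) (2β⟪x,e⟫^{2β-1}⟪v.2,e⟫ - 2βη(‖x‖²)^{β-1}⟪x,v.2⟫)`. [cite: LiSverak2012, §4] -/
theorem fderiv_conePhi_apply (a β η : ℝ) (e : E) {z : ℝ × E} (hz : z ∈ halfDom e) (v : ℝ × E) :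
    fderiv ℝ (conePhi a β η e) z v =
      2 * z.1 * v.1 + a * deriv (kA 1) z.1 * v.1 * conePhi0 β η e z.2 +
        a * kA 1 z.1 * (2 * β * ⟪z.2, e⟫ ^ (2 * β - 1) * ⟪v.2, e⟫ -
          2 * β * η * (‖z.2‖ ^ 2) ^ (β - 1) * ⟪z.2, v.2⟫) := by
  have hx : z.2 ≠ 0 := snd_ne_zero_of_mem_halfDom hz
  have hkd : DifferentiableAt ℝ (kA 1) z.1 := differentiableAt_of_Ioi (contDiffOn_kA 1) hz.1
  have hkd' : DifferentiableAt ℝ (fun t => a * kA 1 t) z.1 := hkd.const_mul a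
  have hkd'' : DifferentiableAt ℝ (fun t => -(a * η) * kA 1 t) z.1 := hkd.const_mul _
  have hρd : DifferentiableAt ℝ (rhoA β) ⟪z.2, e⟫ := differentiableAt_of_Ioi (contDiffOn_rhoA β) hz.2
  have hsq : DifferentiableAt ℝ (fun t : ℝ => t ^ 2) z.1 := (differentiableAt_id).pow 2
  have h1 : DifferentiableAt ℝ (fun y : ℝ × E => (fun t : ℝ => t ^ 2) y.1) z :=
    hsq.comp z differentiableAt_fst
  have h2 : DifferentiableAt ℝ (fun y : ℝ × E => (fun t => a * kA 1 t) y.1 * rhoA β ⟪y.2, e⟫) z := by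
    have h3' := hρd.comp z ((contDiff_inner_snd_const e (n := 1)).differentiable one_ne_zero z)
    have h3 : DifferentiableAt ℝ (fun y : ℝ × E => rhoA β ⟪y.2, e⟫) z := h3'
    exact (hkd'.comp z differentiableAt_fst).mul h3
  have h3 : DifferentiableAt ℝ (fun y : ℝ × E => (fun t => -(a * η) * kA 1 t) y.1 * radPow β y) z :=
    (hkd''.comp z differentiableAt_fst).mul (differentiableAt_radPow β hx)
  have h12 : DifferentiableAt ℝ (fun y : ℝ × E =>
      (fun t : ℝ => t ^ 2) y.1 + (fun t => a * kA 1 t) y.1 * rhoA β ⟪y.2, e⟫) z := h1.add h2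
  rw [conePhi_eq, fderiv_fun_add h12 h3, fderiv_fun_add h1 h2]
  simp only [_root_.add_apply]
  rw [fderiv_comp_fst_apply' hsq, fderiv_sep_apply e hkd' hρd, fderiv_sepRad_apply β hkd'' hx]
  have hd1 : deriv (fun t : ℝ => t ^ 2) z.1 = 2 * z.1 := by simp
  have hd2 : deriv (fun t => a * kA 1 t) z.1 = a * deriv (kA 1) z.1 := deriv_const_mul a hkd
  have hd3 : deriv (fun t => -(a * η) * kA 1 t) z.1 = -(a * η) * deriv (kA 1) z.1 :=
    deriv_const_mul _ hkd
  rw [hd1, hd2, hd3, (rhoA_vals hz.2).2.1, rhoA, radPow_apply, conePhi0]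
  have hs : (⟪z.2, e⟫ : ℝ) ≠ 0 := hz.2.ne'
  have e1 : ⟪z.2, e⟫ ^ (2 * β) / ⟪z.2, e⟫ = ⟪z.2, e⟫ ^ (2 * β - 1) := by
    rw [Real.rpow_sub_one hs]
  rw [← e1]
  field_simp
  ring

/-- **`∂ᵤφ = a k₁(t) ⟪∇φ₀(x), u⟫ = a k₁(t)(2β⟪x,e⟫^{2β-1}⟪u,e⟫ - 2βη(‖x‖²)^{β-1}⟪x,u⟫)`** on `Ω`. [cite: LiSverak2012, §4] -/
theorem dx_conePhi (a β η : ℝ) (e : E) {z : ℝ × E} (hz : z ∈ halfDom e) (u : E) :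
    dx u (conePhi a β η e) z =
      a * kA 1 z.1 * (2 * β * ⟪z.2, e⟫ ^ (2 * β - 1) * ⟪u, e⟫ -
        2 * β * η * (‖z.2‖ ^ 2) ^ (β - 1) * ⟪z.2, u⟫) := by
  rw [dx_apply, fderiv_conePhi_apply a β η e hz]
  simp only [mul_zero, zero_mul, add_zero, zero_add]

/-- **`∂ₜφ = 2t + a k₁'(t) φ₀(x) = 2t - a φ₀(x)/t²`** on `Ω`. [cite: LiSverak2012, §4] -/
theorem dt_conePhi (a β η : ℝ) (e : E) {z : ℝ × E} (hz : z ∈ halfDom e) :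
    dt (conePhi a β η e) z = 2 * z.1 + a * deriv (kA 1) z.1 * conePhi0 β η e z.2 := by
  rw [dt_apply, fderiv_conePhi_apply a β η e hz]
  simp only [inner_zero_right, inner_zero_left, mul_zero, sub_zero, mul_one, add_zero]

/-- `⟪∇φ₀, e⟫ = 2β⟪x,e⟫^{2β-1} - 2βη(‖x‖²)^{β-1}⟪x,e⟫` (`‖e‖ = 1`). [cite: LiSverak2012, §4] -/
theorem inner_coneGrad_axis (β η : ℝ) {e : E} (he : ‖e‖ = 1) (x : E) :
    ⟪coneGrad β η e x, e⟫ = 2 * β * ⟪x, e⟫ ^ (2 * β - 1) - 2 * β * η * (‖x‖ ^ 2) ^ (β - 1) * ⟪x, e⟫ := by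
  have hee : ⟪e, e⟫ = 1 := by rw [real_inner_self_eq_norm_sq, he, one_pow]
  rw [coneGrad, inner_sub_left, real_inner_smul_left, real_inner_smul_left, hee, mul_one]

/-- **Euler's identity** `⟪∇φ₀(x), x⟫ = 2β φ₀(x)` (`φ₀` is homogeneous of degree `2β`), for
`⟪x, e⟫ > 0`. [folklore] -/
theorem inner_coneGrad_self (β η : ℝ) (e : E) {x : E} (hx : 0 < ⟪x, e⟫) :
    ⟪coneGrad β η e x, x⟫ = 2 * β * conePhi0 β η e x := by
  have hx0 : x ≠ 0 := by
    intro h; rw [h, inner_zero_left] at hx; exact lt_irrefl _ hx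
  have hR : (‖x‖ ^ 2 : ℝ) ≠ 0 := by positivity
  rw [coneGrad, inner_sub_left, real_inner_smul_left, real_inner_smul_left, real_inner_comm x e,
    real_inner_self_eq_norm_sq, conePhi0]
  have e1 : ⟪x, e⟫ ^ (2 * β - 1) * ⟪x, e⟫ = ⟪x, e⟫ ^ (2 * β) := by
    rw [Real.rpow_sub_one hx.ne', div_mul_cancel₀ _ hx.ne']
  have e2 : (‖x‖ ^ 2) ^ (β - 1) * ‖x‖ ^ 2 = (‖x‖ ^ 2) ^ β := by
    rw [Real.rpow_sub_one hR, div_mul_cancel₀ _ hR]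
  calc 2 * β * ⟪x, e⟫ ^ (2 * β - 1) * ⟪x, e⟫ - 2 * β * η * (‖x‖ ^ 2) ^ (β - 1) * ‖x‖ ^ 2
      = 2 * β * (⟪x, e⟫ ^ (2 * β - 1) * ⟪x, e⟫) - 2 * β * η * ((‖x‖ ^ 2) ^ (β - 1) * ‖x‖ ^ 2) := by
        ring
    _ = 2 * β * (⟪x, e⟫ ^ (2 * β) - η * (‖x‖ ^ 2) ^ β) := by rw [e1, e2]; ring

/-- **`|∇φ₀|²`** expanded (`‖e‖ = 1`):
`|∇φ₀|² = 4β² (⟪x,e⟫^{2(2β-1)} - 2η (‖x‖²)^{β-1} ⟪x,e⟫^{2β-1}⟪x,e⟫ + η² ((‖x‖²)^{β-1})² ‖x‖²)`. [cite: LiSverak2012, §4] -/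
theorem norm_coneGrad_sq (β η : ℝ) {e : E} (he : ‖e‖ = 1) (x : E) :
    ‖coneGrad β η e x‖ ^ 2 =
      (2 * β * ⟪x, e⟫ ^ (2 * β - 1)) ^ 2 -
        2 * (2 * β * ⟪x, e⟫ ^ (2 * β - 1)) * (2 * β * η * (‖x‖ ^ 2) ^ (β - 1)) * ⟪x, e⟫ +
        (2 * β * η * (‖x‖ ^ 2) ^ (β - 1)) ^ 2 * ‖x‖ ^ 2 := by
  rw [coneGrad, norm_sub_sq_real, norm_smul, norm_smul, real_inner_smul_left, real_inner_smul_right,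
    he, Real.norm_eq_abs, Real.norm_eq_abs, mul_one, mul_pow, sq_abs, sq_abs, real_inner_comm x e]
  ring

variable [FiniteDimensional ℝ E]

/-- **`∇ₓφ = a k₁(t) ∇φ₀(x)`** on `Ω`. [cite: LiSverak2012, §4] -/
theorem gradX_conePhi (a β η : ℝ) (e : E) {z : ℝ × E} (hz : z ∈ halfDom e) :
    gradX (conePhi a β η e) z = (a * kA 1 z.1) • coneGrad β η e z.2 := by
  refine ext_inner_right ℝ fun u => ?_
  rw [inner_gradX, ← dx_apply, dx_conePhi a β η e hz u, coneGrad, real_inner_smul_left,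
    inner_sub_left, real_inner_smul_left, real_inner_smul_left, real_inner_comm e u]

/-- **`|∇ₓφ|² = (a k₁)² |∇φ₀|²`** on `Ω`. [cite: LiSverak2012, §4] -/
theorem norm_gradX_conePhi_sq (a β η : ℝ) (e : E) {z : ℝ × E} (hz : z ∈ halfDom e) :
    ‖gradX (conePhi a β η e) z‖ ^ 2 = (a * kA 1 z.1) ^ 2 * ‖coneGrad β η e z.2‖ ^ 2 := by
  rw [gradX_conePhi a β η e hz, norm_smul, mul_pow, Real.norm_eq_abs, sq_abs]

/-! ### Second derivatives -/

omit [FiniteDimensional ℝ E] in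
/-- `D(⟪x, c⟫)(z) v = ⟪v.2, c⟫` as a `HasFDerivAt` statement. [folklore] -/
theorem hasFDerivAt_inner_snd_const (c : E) (z : ℝ × E) :
    HasFDerivAt (fun y : ℝ × E => ⟪y.2, c⟫)
      ((innerSL ℝ c).comp (ContinuousLinearMap.snd ℝ ℝ E)) z := by
  have e : (fun y : ℝ × E => ⟪y.2, c⟫) =
      fun y => ((innerSL ℝ c).comp (ContinuousLinearMap.snd ℝ ℝ E)) y := by
    funext y; simp [real_inner_comm]
  rw [e]; exact ContinuousLinearMap.hasFDerivAt _

omit [FiniteDimensional ℝ E] in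
/-- **Mixed Hessian of the separable block**: on `Ω`, for `F, f, g ∈ C^∞(]0,∞[)`,
`∂ᵤ∂_w[F(t) + f(t) g(⟪x,e⟫)] = f(t) g''(⟪x,e⟫) ⟪w,e⟫ ⟪u,e⟫`. [folklore] -/
theorem dx_dx_sepAdd_mixed {Fz f g : ℝ → ℝ} (hF : ContDiffOn ℝ (⊤ : ℕ∞) Fz (Ioi 0))
    (hf : ContDiffOn ℝ (⊤ : ℕ∞) f (Ioi 0)) (hg : ContDiffOn ℝ (⊤ : ℕ∞) g (Ioi 0)) (en : E)
    {z : ℝ × E} (hz : z ∈ halfDom en) (w u : E) :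
    dx u (dx w (fun y : ℝ × E => Fz y.1 + f y.1 * g ⟪y.2, en⟫)) z =
      f z.1 * deriv^[2] g ⟪z.2, en⟫ * ⟪w, en⟫ * ⟪u, en⟫ := by
  have hev : dx w (fun y : ℝ × E => Fz y.1 + f y.1 * g ⟪y.2, en⟫) =ᶠ[𝓝 z]
      fun y => (f y.1 * ⟪w, en⟫) * deriv g ⟪y.2, en⟫ := by
    filter_upwards [(isOpen_halfDom en).mem_nhds hz] with y hy
    have hFd : DifferentiableAt ℝ Fz y.1 := differentiableAt_of_Ioi hF hy.1
    have hfd : DifferentiableAt ℝ f y.1 := differentiableAt_of_Ioi hf hy.1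
    have hgd : DifferentiableAt ℝ g ⟪y.2, en⟫ := differentiableAt_of_Ioi hg hy.2
    have h1 : DifferentiableAt ℝ (fun y : ℝ × E => Fz y.1) y := hFd.comp y differentiableAt_fst
    have h2 : DifferentiableAt ℝ (fun y : ℝ × E => f y.1) y := hfd.comp y differentiableAt_fst
    have h3' := hgd.comp y ((contDiff_inner_snd_const en (n := 1)).differentiable one_ne_zero y)
    have h3 : DifferentiableAt ℝ (fun y : ℝ × E => g ⟪y.2, en⟫) y := h3'
    have h23 : DifferentiableAt ℝ (fun y : ℝ × E => f y.1 * g ⟪y.2, en⟫) y := h2.mul h3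
    rw [dx_apply, fderiv_fun_add h1 h23, _root_.add_apply, fderiv_comp_fst_apply' hFd,
      fderiv_sep_apply en hfd hgd]
    simp only [mul_zero, zero_mul, zero_add]
    ring
  rw [dx_apply, hev.fderiv_eq]
  have hfd : DifferentiableAt ℝ (fun t => f t * ⟪w, en⟫) z.1 :=
    (differentiableAt_of_Ioi hf hz.1).mul_const _
  have hgd : DifferentiableAt ℝ (deriv g) ⟪z.2, en⟫ := by
    simpa using differentiableAt_iterate_deriv hg 1 hz.2
  have h := fderiv_sep_apply (f := fun t => f t * ⟪w, en⟫) (g := deriv g) en (z := z) hfd hgd (0, u)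
  rw [show (fun y : ℝ × E => f y.1 * ⟪w, en⟫ * deriv g ⟪y.2, en⟫) =
    fun y => (fun t => f t * ⟪w, en⟫) y.1 * deriv g ⟪y.2, en⟫ from rfl, h]
  simp only [mul_zero, zero_mul, zero_add]
  rw [show deriv (deriv g) ⟪z.2, en⟫ = deriv^[2] g ⟪z.2, en⟫ from rfl]
  ring

omit [FiniteDimensional ℝ E] in
/-- `∂_w[f(t) (‖x‖²)^q] = (2q f(t)) (‖x‖²)^{q-1} ⟪x, w⟫` near every point of `Ω`
(`f ∈ C^∞(]0,∞[)`). [folklore] -/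
theorem dx_sepRad_eventuallyEq {f : ℝ → ℝ} (hf : ContDiffOn ℝ (⊤ : ℕ∞) f (Ioi 0)) (q : ℝ)
    (en : E) {z : ℝ × E} (hz : z ∈ halfDom en) (w : E) :
    dx w (fun y : ℝ × E => f y.1 * radPow q y) =ᶠ[𝓝 z]
      fun y => (fun t => 2 * q * f t) y.1 * radPow (q - 1) y * ⟪y.2, w⟫ := by
  filter_upwards [(isOpen_halfDom en).mem_nhds hz] with y hy
  rw [dx_apply, fderiv_sepRad_apply q (differentiableAt_of_Ioi hf hy.1) (snd_ne_zero_of_mem_halfDom hy)]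
  simp only [zero_mul, mul_zero, zero_add, radPow_apply]
  ring

omit [FiniteDimensional ℝ E] in
/-- **Mixed Hessian of the radial block** on `Ω` (`f ∈ C^∞(]0,∞[)`):
`∂ᵤ∂_w[f(t)(‖x‖²)^q] = f(t) (2q (‖x‖²)^{q-1} ⟪u,w⟫ + 4q(q-1) (‖x‖²)^{q-2} ⟪x,w⟫⟪x,u⟫)`. [folklore] -/
theorem dx_dx_sepRad {f : ℝ → ℝ} (hf : ContDiffOn ℝ (⊤ : ℕ∞) f (Ioi 0)) (q : ℝ) (en : E)
    {z : ℝ × E} (hz : z ∈ halfDom en) (w u : E) :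
    dx u (dx w (fun y : ℝ × E => f y.1 * radPow q y)) z =
      f z.1 * (2 * q * radPow (q - 1) z * ⟪u, w⟫ +
        4 * q * (q - 1) * radPow (q - 2) z * ⟪z.2, w⟫ * ⟪z.2, u⟫) := by
  have hx : z.2 ≠ 0 := snd_ne_zero_of_mem_halfDom hz
  rw [dx_apply, (dx_sepRad_eventuallyEq hf q en hz w).fderiv_eq]
  have hfd : DifferentiableAt ℝ (fun t => 2 * q * f t) z.1 :=
    (differentiableAt_of_Ioi hf hz.1).const_mul _
  have hA : DifferentiableAt ℝ (fun y : ℝ × E => (fun t => 2 * q * f t) y.1 * radPow (q - 1) y) z :=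
    (hfd.comp z differentiableAt_fst).mul (differentiableAt_radPow (q - 1) hx)
  have hB := hasFDerivAt_inner_snd_const w z
  rw [fderiv_fun_mul hA hB.differentiableAt, _root_.add_apply, _root_.smul_apply,
    _root_.smul_apply, hB.fderiv, fderiv_sepRad_apply (q - 1) hfd hx]
  simp only [ContinuousLinearMap.comp_apply, ContinuousLinearMap.coe_snd', innerSL_apply_apply,
    smul_eq_mul, zero_mul, mul_zero, zero_add, radPow_apply, real_inner_comm w u]
  rw [show q - 1 - 1 = q - 2 by ring]
  ring

/-- **Laplacian of the radial block** on `Ω`: `Δ[f(t)(‖x‖²)^q] = 2q(d + 2q - 2) f(t) (‖x‖²)^{q-1}`,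
`d = dim E` (`Σᵢ ⟪x, bᵢ⟫² = ‖x‖²`). [folklore] -/
theorem lap_sepRad {f : ℝ → ℝ} (hf : ContDiffOn ℝ (⊤ : ℕ∞) f (Ioi 0)) (q : ℝ) (en : E)
    {z : ℝ × E} (hz : z ∈ halfDom en) :
    lap (fun y : ℝ × E => f y.1 * radPow q y) z =
      2 * q * ((Module.finrank ℝ E : ℝ) + 2 * q - 2) * f z.1 * radPow (q - 1) z := by
  set b := stdOrthonormalBasis ℝ E with hb
  have hx : z.2 ≠ 0 := snd_ne_zero_of_mem_halfDom hz
  have hbb : ∀ i, ⟪b i, b i⟫ = 1 := fun i => by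
    rw [real_inner_self_eq_norm_sq, b.orthonormal.1 i, one_pow]
  have hs : ∑ i, ⟪z.2, b i⟫ ^ 2 = ‖z.2‖ ^ 2 := b.sum_sq_inner_left z.2
  have step : ∀ i, dx (b i) (dx (b i) (fun y : ℝ × E => f y.1 * radPow q y)) z =
      f z.1 * (2 * q * radPow (q - 1) z) +
        f z.1 * (4 * q * (q - 1) * radPow (q - 2) z) * ⟪z.2, b i⟫ ^ 2 := by
    intro i
    rw [dx_dx_sepRad hf q en hz (b i) (b i), hbb]
    ring
  rw [lap, Finset.sum_congr rfl fun i _ => step i, Finset.sum_add_distrib, Finset.sum_const,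
    Finset.card_univ, Fintype.card_fin, nsmul_eq_mul, ← Finset.mul_sum, hs]
  have e2 : radPow (q - 2) z * ‖z.2‖ ^ 2 = radPow (q - 1) z := by
    have := radPow_sub_one_mul (q - 1) hx
    rwa [show q - 1 - 1 = q - 2 by ring] at this
  calc (Module.finrank ℝ E : ℝ) * (f z.1 * (2 * q * radPow (q - 1) z)) +
        f z.1 * (4 * q * (q - 1) * radPow (q - 2) z) * ‖z.2‖ ^ 2
      = (Module.finrank ℝ E : ℝ) * (f z.1 * (2 * q * radPow (q - 1) z)) +
        f z.1 * (4 * q * (q - 1)) * (radPow (q - 2) z * ‖z.2‖ ^ 2) := by ring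
    _ = _ := by rw [e2]; ring

/-- **Bi-Laplacian of the radial block** on `Ω`:
`Δ²[f(t)(‖x‖²)^q] = 2q(d + 2q - 2) · 2(q-1)(d + 2q - 4) f(t) (‖x‖²)^{q-2}`. [folklore] -/
theorem lap_lap_sepRad {f : ℝ → ℝ} (hf : ContDiffOn ℝ (⊤ : ℕ∞) f (Ioi 0)) (q : ℝ) (en : E)
    {z : ℝ × E} (hz : z ∈ halfDom en) :
    lap (lap (fun y : ℝ × E => f y.1 * radPow q y)) z =
      2 * q * ((Module.finrank ℝ E : ℝ) + 2 * q - 2) *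
        (2 * (q - 1) * ((Module.finrank ℝ E : ℝ) + 2 * (q - 1) - 2)) * f z.1 * radPow (q - 2) z := by
  have hev : lap (fun y : ℝ × E => f y.1 * radPow q y) =ᶠ[𝓝 z]
      fun y => (fun t => (2 * q * ((Module.finrank ℝ E : ℝ) + 2 * q - 2)) * f t) y.1 *
        radPow (q - 1) y := by
    filter_upwards [(isOpen_halfDom en).mem_nhds hz] with y hy
    exact (lap_sepRad hf q en hy).trans (by ring)
  rw [lap_congr_of_eventuallyEq hev, lap_sepRad (contDiffOn_const.mul hf) (q - 1) en hz,
    show q - 1 - 1 = q - 2 by ring]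
  ring

/-! #### The blocks of `φ` and their smoothness -/

omit [FiniteDimensional ℝ E] in
/-- The separable block `S(t,x) = t² + a k₁(t) ⟪x,e⟫^{2β}` is smooth on `Ω`. [folklore] -/
theorem contDiffOn_coneSep (a β : ℝ) (e : E) :
    ContDiffOn ℝ (⊤ : ℕ∞)
      (fun y : ℝ × E => (fun t : ℝ => t ^ 2) y.1 + (fun t => a * kA 1 t) y.1 * rhoA β ⟪y.2, e⟫)
      (halfDom e) := by
  have hk : ContDiffOn ℝ (⊤ : ℕ∞) (fun y : ℝ × E => kA 1 y.1) (halfDom e) :=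
    (contDiffOn_kA 1).comp contDiffOn_fst fun z hz => hz.1
  have hP : ContDiffOn ℝ (⊤ : ℕ∞) (fun y : ℝ × E => rhoA β ⟪y.2, e⟫) (halfDom e) :=
    (contDiffOn_rhoA β).comp (contDiff_inner_snd_const e).contDiffOn fun z hz => hz.2
  exact (contDiff_fst.pow 2).contDiffOn.add ((contDiffOn_const.mul hk).mul hP)

omit [FiniteDimensional ℝ E] in
/-- The radial block `R(t,x) = -aη k₁(t) (‖x‖²)^β` is smooth on `Ω`. [folklore] -/
theorem contDiffOn_coneRad (a β η : ℝ) (e : E) :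
    ContDiffOn ℝ (⊤ : ℕ∞) (fun y : ℝ × E => (fun t => -(a * η) * kA 1 t) y.1 * radPow β y)
      (halfDom e) := by
  have hk : ContDiffOn ℝ (⊤ : ℕ∞) (fun y : ℝ × E => kA 1 y.1) (halfDom e) :=
    (contDiffOn_kA 1).comp contDiffOn_fst fun z hz => hz.1
  have hN : ContDiffOn ℝ (⊤ : ℕ∞) (radPow β : ℝ × E → ℝ) (halfDom e) :=
    (contDiffOn_radPow β).mono (halfDom_subset_snd_ne_zero e)
  exact (contDiffOn_const.mul hk).mul hN

omit [FiniteDimensional ℝ E] in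
/-- `∂_w φ = ∂_w S + ∂_w R` near every point of `Ω` (the two blocks of `conePhi_eq`). [folklore] -/
theorem dx_conePhi_eventuallyEq (a β η : ℝ) (e : E) {z : ℝ × E} (hz : z ∈ halfDom e) (w : E) :
    dx w (conePhi a β η e) =ᶠ[𝓝 z] fun y =>
      dx w (fun y : ℝ × E => (fun t : ℝ => t ^ 2) y.1 + (fun t => a * kA 1 t) y.1 * rhoA β ⟪y.2, e⟫) y +
        dx w (fun y : ℝ × E => (fun t => -(a * η) * kA 1 t) y.1 * radPow β y) y := by
  filter_upwards [(isOpen_halfDom e).mem_nhds hz] with y hy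
  have h1 := ((contDiffOn_coneSep a β e).differentiableOn (by simp)).differentiableAt
    ((isOpen_halfDom e).mem_nhds hy)
  have h2 := ((contDiffOn_coneRad a β η e).differentiableOn (by simp)).differentiableAt
    ((isOpen_halfDom e).mem_nhds hy)
  rw [dx_apply, conePhi_eq, dx_apply, dx_apply]
  exact congrFun (congrArg DFunLike.coe (fderiv_add h1 h2)) (0, w)

omit [FiniteDimensional ℝ E] in
/-- **The frame Hessian of `φ`** on `Ω` (paper, (4.5)):
`∂ᵤ∂_w φ = a k₁(t) [2β(2β-1)⟪x,e⟫^{2β-2}⟪w,e⟫⟪u,e⟫ - η(2β(‖x‖²)^{β-1}⟪u,w⟫ + 4β(β-1)(‖x‖²)^{β-2}⟪x,w⟫⟪x,u⟫)]`. [cite: LiSverak2012, §4 (4.5)] -/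
theorem dx_dx_conePhi (a β η : ℝ) (e : E) {z : ℝ × E} (hz : z ∈ halfDom e) (w u : E) :
    dx u (dx w (conePhi a β η e)) z =
      a * kA 1 z.1 * (2 * β * (2 * β - 1) * ⟪z.2, e⟫ ^ (2 * β - 2) * ⟪w, e⟫ * ⟪u, e⟫ -
        η * (2 * β * (‖z.2‖ ^ 2) ^ (β - 1) * ⟪u, w⟫ +
          4 * β * (β - 1) * (‖z.2‖ ^ 2) ^ (β - 2) * ⟪z.2, w⟫ * ⟪z.2, u⟫)) := by
  have hO := isOpen_halfDom e
  have hS := contDiffOn_coneSep a β e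
  have hR := contDiffOn_coneRad a β η e
  have h1 : DifferentiableAt ℝ
      (dx w (fun y : ℝ × E => (fun t : ℝ => t ^ 2) y.1 + (fun t => a * kA 1 t) y.1 * rhoA β ⟪y.2, e⟫)) z :=
    ((contDiffOn_fderiv_apply_const_of_open hO hS (0, w)).differentiableOn (by simp)).differentiableAt
      (hO.mem_nhds hz)
  have h2 : DifferentiableAt ℝ
      (dx w (fun y : ℝ × E => (fun t => -(a * η) * kA 1 t) y.1 * radPow β y)) z :=
    ((contDiffOn_fderiv_apply_const_of_open hO hR (0, w)).differentiableOn (by simp)).differentiableAt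
      (hO.mem_nhds hz)
  have hF : ContDiffOn ℝ (⊤ : ℕ∞) (fun t : ℝ => t ^ 2) (Ioi 0) := (contDiff_id.pow 2).contDiffOn
  have hf : ContDiffOn ℝ (⊤ : ℕ∞) (fun t : ℝ => a * kA 1 t) (Ioi 0) :=
    contDiffOn_const.mul (contDiffOn_kA 1)
  have hf' : ContDiffOn ℝ (⊤ : ℕ∞) (fun t : ℝ => -(a * η) * kA 1 t) (Ioi 0) :=
    contDiffOn_const.mul (contDiffOn_kA 1)
  rw [dx_apply, (dx_conePhi_eventuallyEq a β η e hz w).fderiv_eq, fderiv_fun_add h1 h2,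
    _root_.add_apply, ← dx_apply, ← dx_apply, dx_dx_sepAdd_mixed hF hf (contDiffOn_rhoA β) e hz w u,
    dx_dx_sepRad hf' β e hz w u, (rhoA_vals hz.2).2.2.1, radPow_apply, radPow_apply]
  have hs : (⟪z.2, e⟫ : ℝ) ≠ 0 := hz.2.ne'
  have e1 : ⟪z.2, e⟫ ^ (2 * β) / ⟪z.2, e⟫ ^ 2 = ⟪z.2, e⟫ ^ (2 * β - 2) := by
    rw [show (2 * β - 2 : ℝ) = 2 * β - ((2 : ℕ) : ℝ) by norm_num, rpow_two_mul_sub_nat hz.2]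
  rw [← e1]
  field_simp
  ring

/-- **`Δφ = a k₁(t) [2β(2β-1)⟪x,e⟫^{2β-2} - 2βη(d + 2β - 2)(‖x‖²)^{β-1}]`** on `Ω` (`‖e‖ = 1`). [cite: LiSverak2012, §4] -/
theorem lap_conePhi (a β η : ℝ) {e : E} (he : ‖e‖ = 1) {z : ℝ × E} (hz : z ∈ halfDom e) :
    lap (conePhi a β η e) z =
      a * kA 1 z.1 * (2 * β * (2 * β - 1) * ⟪z.2, e⟫ ^ (2 * β - 2) -
        η * (2 * β * ((Module.finrank ℝ E : ℝ) + 2 * β - 2) * (‖z.2‖ ^ 2) ^ (β - 1))) := by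
  set b := stdOrthonormalBasis ℝ E with hb
  have hx : z.2 ≠ 0 := snd_ne_zero_of_mem_halfDom hz
  have hbb : ∀ i, ⟪b i, b i⟫ = 1 := fun i => by
    rw [real_inner_self_eq_norm_sq, b.orthonormal.1 i, one_pow]
  have hs1 : ∑ i, ⟪b i, e⟫ ^ 2 = 1 := by rw [b.sum_sq_inner_right e, he, one_pow]
  have hs2 : ∑ i, ⟪z.2, b i⟫ ^ 2 = ‖z.2‖ ^ 2 := b.sum_sq_inner_left z.2
  have step : ∀ i, dx (b i) (dx (b i) (conePhi a β η e)) z =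
      a * kA 1 z.1 * (2 * β * (2 * β - 1) * ⟪z.2, e⟫ ^ (2 * β - 2)) * ⟪b i, e⟫ ^ 2 +
        (-(a * kA 1 z.1 * (η * (2 * β * (‖z.2‖ ^ 2) ^ (β - 1))))) +
        (-(a * kA 1 z.1 * (η * (4 * β * (β - 1) * (‖z.2‖ ^ 2) ^ (β - 2))))) *
          ⟪z.2, b i⟫ ^ 2 := by
    intro i
    rw [dx_dx_conePhi a β η e hz (b i) (b i), hbb]
    ring
  rw [lap, Finset.sum_congr rfl fun i _ => step i, Finset.sum_add_distrib, Finset.sum_add_distrib,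
    ← Finset.mul_sum, hs1, Finset.sum_const, Finset.card_univ, Fintype.card_fin, nsmul_eq_mul,
    ← Finset.mul_sum, hs2]
  have e2 : (‖z.2‖ ^ 2) ^ (β - 2) * ‖z.2‖ ^ 2 = (‖z.2‖ ^ 2) ^ (β - 1) := by
    have := radPow_sub_one_mul (β - 1) hx
    simp only [radPow_apply] at this
    rwa [show β - 1 - 1 = β - 2 by ring] at this
  calc a * kA 1 z.1 * (2 * β * (2 * β - 1) * ⟪z.2, e⟫ ^ (2 * β - 2)) * 1 +
        (Module.finrank ℝ E : ℝ) * -(a * kA 1 z.1 * (η * (2 * β * (‖z.2‖ ^ 2) ^ (β - 1)))) +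
        -(a * kA 1 z.1 * (η * (4 * β * (β - 1) * (‖z.2‖ ^ 2) ^ (β - 2)))) * ‖z.2‖ ^ 2
      = a * kA 1 z.1 * (2 * β * (2 * β - 1) * ⟪z.2, e⟫ ^ (2 * β - 2)) +
        (Module.finrank ℝ E : ℝ) * -(a * kA 1 z.1 * (η * (2 * β * (‖z.2‖ ^ 2) ^ (β - 1)))) +
        -(a * kA 1 z.1 * (η * (4 * β * (β - 1)))) * ((‖z.2‖ ^ 2) ^ (β - 2) * ‖z.2‖ ^ 2) := by ring
    _ = _ := by rw [e2]; ring

/-! #### Linearity of second derivatives for functions smooth on `Ω` -/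

omit [FiniteDimensional ℝ E] in
/-- `∂ᵤ∂_w(A + B) = ∂ᵤ∂_w A + ∂ᵤ∂_w B` at points of an open set on which `A`, `B` are smooth. [folklore] -/
theorem dx_dx_add_of_contDiffOn {Ω : Set (ℝ × E)} (hΩ : IsOpen Ω) {A B : ℝ × E → ℝ}
    (hA : ContDiffOn ℝ (⊤ : ℕ∞) A Ω) (hB : ContDiffOn ℝ (⊤ : ℕ∞) B Ω) {z : ℝ × E} (hz : z ∈ Ω)
    (w u : E) :
    dx u (dx w (fun y => A y + B y)) z = dx u (dx w A) z + dx u (dx w B) z := by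
  have hev : dx w (fun y => A y + B y) =ᶠ[𝓝 z] fun y => dx w A y + dx w B y := by
    filter_upwards [hΩ.mem_nhds hz] with y hy
    have h1 := (hA.differentiableOn (by simp)).differentiableAt (hΩ.mem_nhds hy)
    have h2 := (hB.differentiableOn (by simp)).differentiableAt (hΩ.mem_nhds hy)
    rw [dx_apply, dx_apply, dx_apply]
    exact congrFun (congrArg DFunLike.coe (fderiv_fun_add h1 h2)) (0, w)
  have h1 : DifferentiableAt ℝ (dx w A) z :=
    ((contDiffOn_fderiv_apply_const_of_open hΩ hA (0, w)).differentiableOn (by simp)).differentiableAt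
      (hΩ.mem_nhds hz)
  have h2 : DifferentiableAt ℝ (dx w B) z :=
    ((contDiffOn_fderiv_apply_const_of_open hΩ hB (0, w)).differentiableOn (by simp)).differentiableAt
      (hΩ.mem_nhds hz)
  rw [dx_apply, hev.fderiv_eq, fderiv_fun_add h1 h2, _root_.add_apply, ← dx_apply, ← dx_apply]

/-- `Δ(A + B) = ΔA + ΔB` at points of an open set on which `A`, `B` are smooth. [folklore] -/
theorem lap_add_of_contDiffOn {Ω : Set (ℝ × E)} (hΩ : IsOpen Ω) {A B : ℝ × E → ℝ}
    (hA : ContDiffOn ℝ (⊤ : ℕ∞) A Ω) (hB : ContDiffOn ℝ (⊤ : ℕ∞) B Ω) {z : ℝ × E} (hz : z ∈ Ω) :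
    lap (fun y => A y + B y) z = lap A z + lap B z := by
  simp only [lap, ← Finset.sum_add_distrib]
  exact Finset.sum_congr rfl fun i _ => dx_dx_add_of_contDiffOn hΩ hA hB hz _ _

/-! #### `Δ²φ`, `∂ₜ²φ`, `∂ₜ|∇φ|²` -/

/-- **`Δ²φ = a k₁(t)[2β(2β-1)(2β-2)(2β-3)⟪x,e⟫^{2β-4} - 2βη(d+2β-2)·2(β-1)(d+2β-4)(‖x‖²)^{β-2}]`**
on `Ω` (`‖e‖ = 1`). [cite: LiSverak2012, §4] -/
theorem lap_lap_conePhi (a β η : ℝ) {e : E} (he : ‖e‖ = 1) {z : ℝ × E} (hz : z ∈ halfDom e) :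
    lap (lap (conePhi a β η e)) z =
      a * kA 1 z.1 * (2 * β * (2 * β - 1) * (2 * β - 2) * (2 * β - 3) * ⟪z.2, e⟫ ^ (2 * β - 4) -
        η * (2 * β * ((Module.finrank ℝ E : ℝ) + 2 * β - 2) *
          (2 * (β - 1) * ((Module.finrank ℝ E : ℝ) + 2 * (β - 1) - 2)) * (‖z.2‖ ^ 2) ^ (β - 2))) := by
  have hO := isOpen_halfDom e
  -- `Δφ` near `z` is again a sum of a separable and a radial block
  set A : ℝ × E → ℝ := fun y => (fun _ : ℝ => (0 : ℝ)) y.1 +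
    (fun t => a * (2 * β * (2 * β - 1)) * kA 1 t) y.1 * rhoA (β - 1) ⟪y.2, e⟫ with hA
  set B : ℝ × E → ℝ := fun y =>
    (fun t => -(a * η * (2 * β * ((Module.finrank ℝ E : ℝ) + 2 * β - 2))) * kA 1 t) y.1 *
      radPow (β - 1) y with hB
  have hev : lap (conePhi a β η e) =ᶠ[𝓝 z] fun y => A y + B y := by
    filter_upwards [hO.mem_nhds hz] with y hy
    rw [lap_conePhi a β η he hy, hA, hB]
    simp only [rhoA, radPow_apply, show 2 * (β - 1) = 2 * β - 2 by ring]
    ring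
  have hf1 : ContDiffOn ℝ (⊤ : ℕ∞) (fun t : ℝ => a * (2 * β * (2 * β - 1)) * kA 1 t) (Ioi 0) :=
    contDiffOn_const.mul (contDiffOn_kA 1)
  have hf2 : ContDiffOn ℝ (⊤ : ℕ∞)
      (fun t : ℝ => -(a * η * (2 * β * ((Module.finrank ℝ E : ℝ) + 2 * β - 2))) * kA 1 t) (Ioi 0) :=
    contDiffOn_const.mul (contDiffOn_kA 1)
  have hAs : ContDiffOn ℝ (⊤ : ℕ∞) A (halfDom e) := by
    have hk : ContDiffOn ℝ (⊤ : ℕ∞) (fun y : ℝ × E => kA 1 y.1) (halfDom e) :=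
      (contDiffOn_kA 1).comp contDiffOn_fst fun z hz => hz.1
    have hP : ContDiffOn ℝ (⊤ : ℕ∞) (fun y : ℝ × E => rhoA (β - 1) ⟪y.2, e⟫) (halfDom e) :=
      (contDiffOn_rhoA (β - 1)).comp (contDiff_inner_snd_const e).contDiffOn fun z hz => hz.2
    rw [hA]
    exact contDiffOn_const.add ((contDiffOn_const.mul hk).mul hP)
  have hBs : ContDiffOn ℝ (⊤ : ℕ∞) B (halfDom e) := by
    have hk : ContDiffOn ℝ (⊤ : ℕ∞) (fun y : ℝ × E => kA 1 y.1) (halfDom e) :=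
      (contDiffOn_kA 1).comp contDiffOn_fst fun z hz => hz.1
    have hN : ContDiffOn ℝ (⊤ : ℕ∞) (radPow (β - 1) : ℝ × E → ℝ) (halfDom e) :=
      (contDiffOn_radPow (β - 1)).mono (halfDom_subset_snd_ne_zero e)
    rw [hB]
    exact (contDiffOn_const.mul hk).mul hN
  rw [lap_congr_of_eventuallyEq hev, lap_add_of_contDiffOn hO hAs hBs hz, hA, hB,
    lap_sepAdd contDiffOn_const hf1 (contDiffOn_rhoA (β - 1)) he hz, lap_sepRad hf2 (β - 1) e hz,
    deriv2_rhoA, radPow_apply, show β - 1 - 1 = β - 2 by ring,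
    show 2 * (β - 1) - 2 = 2 * β - 4 by ring]
  ring

omit [FiniteDimensional ℝ E] in
/-- **`∂ₜ²φ = 2 + a k₁''(t) φ₀(x)`** on `Ω`. [cite: LiSverak2012, §4] -/
theorem dt_dt_conePhi (a β η : ℝ) (e : E) {z : ℝ × E} (hz : z ∈ halfDom e) :
    dt (dt (conePhi a β η e)) z = 2 + a * deriv^[2] (kA 1) z.1 * conePhi0 β η e z.2 := by
  have hx : z.2 ≠ 0 := snd_ne_zero_of_mem_halfDom hz
  have hev : dt (conePhi a β η e) =ᶠ[𝓝 z] fun y =>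
      ((fun t : ℝ => 2 * t) y.1 + (fun t => a * deriv (kA 1) t) y.1 * rhoA β ⟪y.2, e⟫) +
        (fun t => -(a * η) * deriv (kA 1) t) y.1 * radPow β y := by
    filter_upwards [(isOpen_halfDom e).mem_nhds hz] with y hy
    rw [dt_conePhi a β η e hy, conePhi0, rhoA, radPow_apply]
    ring
  have hk1 : DifferentiableAt ℝ (deriv (kA 1)) z.1 := by
    simpa using differentiableAt_iterate_deriv (contDiffOn_kA 1) 1 hz.1
  have hlin : DifferentiableAt ℝ (fun t : ℝ => 2 * t) z.1 := differentiableAt_id.const_mul _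
  have hkd : DifferentiableAt ℝ (fun t => a * deriv (kA 1) t) z.1 := hk1.const_mul a
  have hkd' : DifferentiableAt ℝ (fun t => -(a * η) * deriv (kA 1) t) z.1 := hk1.const_mul _
  have hρd : DifferentiableAt ℝ (rhoA β) ⟪z.2, e⟫ := differentiableAt_of_Ioi (contDiffOn_rhoA β) hz.2
  have h1 : DifferentiableAt ℝ (fun y : ℝ × E => (fun t : ℝ => 2 * t) y.1) z :=
    hlin.comp z differentiableAt_fst
  have h2 : DifferentiableAt ℝ (fun y : ℝ × E => (fun t => a * deriv (kA 1) t) y.1 * rhoA β ⟪y.2, e⟫) z := by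
    have h3' := hρd.comp z ((contDiff_inner_snd_const e (n := 1)).differentiable one_ne_zero z)
    have h3 : DifferentiableAt ℝ (fun y : ℝ × E => rhoA β ⟪y.2, e⟫) z := h3'
    exact (hkd.comp z differentiableAt_fst).mul h3
  have h12 : DifferentiableAt ℝ (fun y : ℝ × E =>
      (fun t : ℝ => 2 * t) y.1 + (fun t => a * deriv (kA 1) t) y.1 * rhoA β ⟪y.2, e⟫) z := h1.add h2
  have h3 : DifferentiableAt ℝ (fun y : ℝ × E => (fun t => -(a * η) * deriv (kA 1) t) y.1 * radPow β y) z :=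
    (hkd'.comp z differentiableAt_fst).mul (differentiableAt_radPow β hx)
  rw [dt_apply, hev.fderiv_eq, fderiv_fun_add h12 h3, fderiv_fun_add h1 h2]
  simp only [_root_.add_apply]
  rw [fderiv_comp_fst_apply' hlin, fderiv_sep_apply e hkd hρd, fderiv_sepRad_apply β hkd' hx]
  have hd1 : deriv (fun t : ℝ => 2 * t) z.1 = 2 := by
    rw [deriv_const_mul _ differentiableAt_id, deriv_id'', mul_one]
  have hd2 : deriv (fun t => a * deriv (kA 1) t) z.1 = a * deriv^[2] (kA 1) z.1 := by
    rw [deriv_const_mul a hk1]; rfl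
  have hd3 : deriv (fun t => -(a * η) * deriv (kA 1) t) z.1 = -(a * η) * deriv^[2] (kA 1) z.1 := by
    rw [deriv_const_mul _ hk1]; rfl
  rw [hd1, hd2, hd3]
  simp only [inner_zero_right, inner_zero_left, mul_zero, mul_one, add_zero, radPow_apply,
    conePhi0, rhoA]
  ring

omit [FiniteDimensional ℝ E] in
/-- `∇φ₀` is smooth on `{⟪x, e⟫ > 0}`. [folklore] -/
theorem contDiffOn_coneGrad (β η : ℝ) (e : E) :
    ContDiffOn ℝ (⊤ : ℕ∞) (coneGrad β η e) {x : E | 0 < ⟪x, e⟫} := by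
  have h1 : ContDiffOn ℝ (⊤ : ℕ∞) (fun x : E => ⟪x, e⟫ ^ (2 * β - 1)) {x : E | 0 < ⟪x, e⟫} :=
    (contDiff_id.inner ℝ contDiff_const).contDiffOn.rpow_const_of_ne fun x hx => ne_of_gt hx
  have h2 : ContDiffOn ℝ (⊤ : ℕ∞) (fun x : E => (‖x‖ ^ 2) ^ (β - 1)) {x : E | 0 < ⟪x, e⟫} := by
    refine (contDiff_id.norm_sq ℝ).contDiffOn.rpow_const_of_ne fun x hx => ?_
    have hx0 : x ≠ 0 := by
      intro h
      have : (0 : ℝ) < ⟪x, e⟫ := hx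
      rw [h, inner_zero_left] at this
      exact lt_irrefl _ this
    simp only [id]
    positivity
  unfold coneGrad
  exact ((contDiffOn_const.mul h1).smul contDiffOn_const).sub
    (((contDiffOn_const.mul contDiffOn_const).mul h2).smul contDiffOn_id)

/-- **`∂ₜ|∇φ|² = 2 (a k₁(t)) (a k₁'(t)) |∇φ₀(x)|²`** on `Ω`. [cite: LiSverak2012, §4] -/
theorem dt_norm_gradX_conePhi_sq (a β η : ℝ) (e : E) {z : ℝ × E} (hz : z ∈ halfDom e) :
    dt (fun y => ‖gradX (conePhi a β η e) y‖ ^ 2) z =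
      2 * (a * kA 1 z.1) * (a * deriv (kA 1) z.1) * ‖coneGrad β η e z.2‖ ^ 2 := by
  set Q : E → ℝ := fun x => ‖coneGrad β η e x‖ ^ 2 with hQ
  have hev : (fun y => ‖gradX (conePhi a β η e) y‖ ^ 2) =ᶠ[𝓝 z] fun y =>
      (fun t => (a * kA 1 t) ^ 2) y.1 * Q y.2 := by
    filter_upwards [(isOpen_halfDom e).mem_nhds hz] with y hy
    rw [norm_gradX_conePhi_sq a β η e hy]
  have hkd : DifferentiableAt ℝ (kA 1) z.1 := differentiableAt_of_Ioi (contDiffOn_kA 1) hz.1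
  have hF : DifferentiableAt ℝ (fun t => (a * kA 1 t) ^ 2) z.1 := (hkd.const_mul a).pow 2
  have hQd : DifferentiableAt ℝ Q z.2 := by
    have hO : IsOpen {x : E | 0 < ⟪x, e⟫} := isOpen_lt continuous_const (continuous_id.inner continuous_const)
    have h := ((contDiffOn_coneGrad β η e).norm_sq ℝ).differentiableOn (by simp)
    exact h.differentiableAt (hO.mem_nhds hz.2)
  have hQ2 : HasFDerivAt (fun y : ℝ × E => Q y.2) ((fderiv ℝ Q z.2).comp (ContinuousLinearMap.snd ℝ ℝ E)) z :=
    hQd.hasFDerivAt.comp z hasFDerivAt_snd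
  have h1 : DifferentiableAt ℝ (fun y : ℝ × E => (fun t => (a * kA 1 t) ^ 2) y.1) z :=
    hF.comp z differentiableAt_fst
  rw [dt_apply, hev.fderiv_eq, fderiv_fun_mul h1 hQ2.differentiableAt, _root_.add_apply,
    _root_.smul_apply, _root_.smul_apply, hQ2.fderiv, fderiv_comp_fst_apply' hF]
  have hd : deriv (fun t => (a * kA 1 t) ^ 2) z.1 = 2 * (a * kA 1 z.1) * (a * deriv (kA 1) z.1) := by
    have h' : HasDerivAt (fun t => (a * kA 1 t) ^ 2) (2 * (a * kA 1 z.1) * (a * deriv (kA 1) z.1)) z.1 :=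
      ((hkd.hasDerivAt.const_mul a).pow 2).congr_deriv (by norm_num)
    exact h'.deriv
  rw [hd]
  simp only [ContinuousLinearMap.comp_apply, ContinuousLinearMap.coe_snd', map_zero, smul_eq_mul,
    mul_zero, mul_one, hQ]
  ring

/-! #### The two contractions of the Hessian -/

/-- **The Hessian contracted with `∇v ⊗ ∇v`** (paper, (4.5) applied in (4.4)): on `Ω`,
`Σᵢⱼ φᵢⱼ ⟪∂ⱼv, ∂ᵢv⟫ = a k₁ [2β(2β-1)⟪x,e⟫^{2β-2} |Dv(0,e)|² - η(2β(‖x‖²)^{β-1}|∇v|² + 4β(β-1)(‖x‖²)^{β-2}|Dv(0,x)|²)]`. [cite: LiSverak2012, §4 (4.4)–(4.5)] -/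
theorem sum_hess_conePhi_inner (a β η : ℝ) (e : E) {z : ℝ × E} (hz : z ∈ halfDom e)
    (V : ℝ × E → F) :
    ∑ i, ∑ j, dx (stdOrthonormalBasis ℝ E i) (dx (stdOrthonormalBasis ℝ E j) (conePhi a β η e)) z *
        ⟪dx (stdOrthonormalBasis ℝ E j) V z, dx (stdOrthonormalBasis ℝ E i) V z⟫ =
      a * kA 1 z.1 * (2 * β * (2 * β - 1) * ⟪z.2, e⟫ ^ (2 * β - 2) * ‖fderiv ℝ V z (0, e)‖ ^ 2 -
        η * (2 * β * (‖z.2‖ ^ 2) ^ (β - 1) * gradSq V z +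
          4 * β * (β - 1) * (‖z.2‖ ^ 2) ^ (β - 2) * ‖fderiv ℝ V z (0, z.2)‖ ^ 2)) := by
  set b := stdOrthonormalBasis ℝ E with hb
  set P : Fin (Module.finrank ℝ E) → Fin (Module.finrank ℝ E) → ℝ :=
    fun j i => ⟪dx (b j) V z, dx (b i) V z⟫ with hP
  set c₁ : ℝ := a * kA 1 z.1 * (2 * β * (2 * β - 1) * ⟪z.2, e⟫ ^ (2 * β - 2)) with hc₁
  set c₂ : ℝ := a * kA 1 z.1 * (η * (2 * β * (‖z.2‖ ^ 2) ^ (β - 1))) with hc₂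
  set c₃ : ℝ := a * kA 1 z.1 * (η * (4 * β * (β - 1) * (‖z.2‖ ^ 2) ^ (β - 2))) with hc₃
  have step : ∀ i j, dx (b i) (dx (b j) (conePhi a β η e)) z * ⟪dx (b j) V z, dx (b i) V z⟫ =
      c₁ * (⟪b i, e⟫ * ⟪b j, e⟫ * P j i) + (-c₂) * (⟪b i, b j⟫ * P j i) +
        (-c₃) * (⟪b i, z.2⟫ * ⟪b j, z.2⟫ * P j i) := by
    intro i j
    rw [dx_dx_conePhi a β η e hz (b j) (b i), hP, hc₁, hc₂, hc₃, real_inner_comm (b i) z.2,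
      real_inner_comm (b j) z.2]
    ring
  have h1 : ∑ i, ∑ j, ⟪b i, b j⟫ * P j i = gradSq V z := by
    rw [sum_sum_inner_basis_mul]
    simp only [hP, real_inner_self_eq_norm_sq, gradSq]
    rfl
  have h2 : ∀ c : E, ∑ i, ∑ j, ⟪b i, c⟫ * ⟪b j, c⟫ * P j i = ‖fderiv ℝ V z (0, c)‖ ^ 2 := by
    intro c
    rw [fderiv_apply_zero_eq_sum_smul, ← real_inner_self_eq_norm_sq, inner_sum]
    simp only [← hb]
    refine Finset.sum_congr rfl fun i _ => ?_
    rw [sum_inner]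
    refine Finset.sum_congr rfl fun j _ => ?_
    rw [real_inner_smul_left, real_inner_smul_right, hP]
    ring
  calc ∑ i, ∑ j, dx (b i) (dx (b j) (conePhi a β η e)) z * ⟪dx (b j) V z, dx (b i) V z⟫
      = ∑ i, ∑ j, (c₁ * (⟪b i, e⟫ * ⟪b j, e⟫ * P j i) + (-c₂) * (⟪b i, b j⟫ * P j i) +
          (-c₃) * (⟪b i, z.2⟫ * ⟪b j, z.2⟫ * P j i)) :=
        Finset.sum_congr rfl fun i _ => Finset.sum_congr rfl fun j _ => step i j
    _ = c₁ * ∑ i, ∑ j, ⟪b i, e⟫ * ⟪b j, e⟫ * P j i + (-c₂) * ∑ i, ∑ j, ⟪b i, b j⟫ * P j i +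
          (-c₃) * ∑ i, ∑ j, ⟪b i, z.2⟫ * ⟪b j, z.2⟫ * P j i := by
        simp only [Finset.sum_add_distrib, Finset.mul_sum]
    _ = _ := by
        rw [h1, h2 e, h2 z.2, hc₁, hc₂, hc₃]
        ring

/-- **The Hessian contracted with `∇φ ⊗ ∇φ`** (paper, (4.6)): on `Ω`,
`Σᵢⱼ φᵢⱼ φᵢ φⱼ = a k₁ [2β(2β-1)⟪x,e⟫^{2β-2} ⟪∇φ,e⟫² - η(2β(‖x‖²)^{β-1}|∇φ|² + 4β(β-1)(‖x‖²)^{β-2}⟪∇φ,x⟫²)]`,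
`∇φ = ∇ₓφ(z) = a k₁ ∇φ₀`. [cite: LiSverak2012, §4 (4.6)] -/
theorem sum_hess_conePhi_grad (a β η : ℝ) (e : E) {z : ℝ × E} (hz : z ∈ halfDom e) :
    ∑ i, ∑ j, dx (stdOrthonormalBasis ℝ E i) (dx (stdOrthonormalBasis ℝ E j) (conePhi a β η e)) z *
        dx (stdOrthonormalBasis ℝ E i) (conePhi a β η e) z *
          dx (stdOrthonormalBasis ℝ E j) (conePhi a β η e) z =
      a * kA 1 z.1 * (2 * β * (2 * β - 1) * ⟪z.2, e⟫ ^ (2 * β - 2) * ⟪gradX (conePhi a β η e) z, e⟫ ^ 2 -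
        η * (2 * β * (‖z.2‖ ^ 2) ^ (β - 1) * ‖gradX (conePhi a β η e) z‖ ^ 2 +
          4 * β * (β - 1) * (‖z.2‖ ^ 2) ^ (β - 2) * ⟪gradX (conePhi a β η e) z, z.2⟫ ^ 2)) := by
  set b := stdOrthonormalBasis ℝ E with hb
  set g : E := gradX (conePhi a β η e) z with hg
  set c₁ : ℝ := a * kA 1 z.1 * (2 * β * (2 * β - 1) * ⟪z.2, e⟫ ^ (2 * β - 2)) with hc₁
  set c₂ : ℝ := a * kA 1 z.1 * (η * (2 * β * (‖z.2‖ ^ 2) ^ (β - 1))) with hc₂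
  set c₃ : ℝ := a * kA 1 z.1 * (η * (4 * β * (β - 1) * (‖z.2‖ ^ 2) ^ (β - 2))) with hc₃
  have hgi : ∀ i, dx (b i) (conePhi a β η e) z = ⟪g, b i⟫ := fun i => (inner_gradX_basis _ z i).symm
  have step : ∀ i j, dx (b i) (dx (b j) (conePhi a β η e)) z * dx (b i) (conePhi a β η e) z *
      dx (b j) (conePhi a β η e) z =
      c₁ * ((⟪g, b i⟫ * ⟪b i, e⟫) * (⟪g, b j⟫ * ⟪b j, e⟫)) +
        (-c₂) * (⟪b i, b j⟫ * (⟪g, b j⟫ * ⟪g, b i⟫)) +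
        (-c₃) * ((⟪g, b i⟫ * ⟪b i, z.2⟫) * (⟪g, b j⟫ * ⟪b j, z.2⟫)) := by
    intro i j
    rw [dx_dx_conePhi a β η e hz (b j) (b i), hgi, hgi, hc₁, hc₂, hc₃, real_inner_comm (b i) z.2,
      real_inner_comm (b j) z.2]
    ring
  have h1 : ∑ i, ∑ j, ⟪b i, b j⟫ * (⟪g, b j⟫ * ⟪g, b i⟫) = ‖g‖ ^ 2 := by
    rw [sum_sum_inner_basis_mul (P := fun j i => ⟪g, b j⟫ * ⟪g, b i⟫), ← b.sum_sq_inner_left g]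
    simp [sq]
  have h2 : ∀ c : E, ∑ i, ∑ j, (⟪g, b i⟫ * ⟪b i, c⟫) * (⟪g, b j⟫ * ⟪b j, c⟫) = ⟪g, c⟫ ^ 2 := by
    intro c
    rw [← Finset.sum_mul_sum, b.sum_inner_mul_inner g c, sq]
  calc ∑ i, ∑ j, dx (b i) (dx (b j) (conePhi a β η e)) z * dx (b i) (conePhi a β η e) z *
        dx (b j) (conePhi a β η e) z
      = ∑ i, ∑ j, (c₁ * ((⟪g, b i⟫ * ⟪b i, e⟫) * (⟪g, b j⟫ * ⟪b j, e⟫)) +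
          (-c₂) * (⟪b i, b j⟫ * (⟪g, b j⟫ * ⟪g, b i⟫)) +
          (-c₃) * ((⟪g, b i⟫ * ⟪b i, z.2⟫) * (⟪g, b j⟫ * ⟪b j, z.2⟫))) :=
        Finset.sum_congr rfl fun i _ => Finset.sum_congr rfl fun j _ => step i j
    _ = c₁ * ∑ i, ∑ j, (⟪g, b i⟫ * ⟪b i, e⟫) * (⟪g, b j⟫ * ⟪b j, e⟫) +
          (-c₂) * ∑ i, ∑ j, ⟪b i, b j⟫ * (⟪g, b j⟫ * ⟪g, b i⟫) +
          (-c₃) * ∑ i, ∑ j, (⟪g, b i⟫ * ⟪b i, z.2⟫) * (⟪g, b j⟫ * ⟪b j, z.2⟫) := by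
        simp only [Finset.sum_add_distrib, Finset.mul_sum]
    _ = _ := by
        rw [h1, h2 e, h2 z.2, hc₁, hc₂, hc₃]
        ring

/-! ### The compensating multiplier `G = 2t · a k₁(t) · f(x)`, `f = 2βη(‖x‖²)^{β-1}` -/

/-- Li–Šverák's compensating multiplier (paper, (4.7): `F = 4aΛf + 1` in the unweighted
splitting; here, for Seregin's `tL = S + A`, `G = 2t a k₁(t) f(x)` with
`f = αε^α|x|^{α-2} = 2βη(‖x‖²)^{β-1}`), chosen so that `D²φ₀ + f·I ≥ 0`. [cite: LiSverak2012, §4 (4.7)] -/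
def coneG (a β η : ℝ) (z : ℝ × E) : ℝ :=
  2 * z.1 * (a * kA 1 z.1) * (2 * β * η * (‖z.2‖ ^ 2) ^ (β - 1))

omit [InnerProductSpace ℝ E] [FiniteDimensional ℝ E] in
/-- `G` as a radial block: `G = (4aβη t k₁(t)) (‖x‖²)^{β-1}`. [folklore] -/
theorem coneG_eq (a β η : ℝ) :
    (coneG a β η : ℝ × E → ℝ) = fun y => (fun t => 4 * a * β * η * (t * kA 1 t)) y.1 * radPow (β - 1) y := by
  funext y
  simp only [coneG, radPow_apply]
  ring

omit [FiniteDimensional ℝ E] in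
/-- The time profile `t k₁(t)` is smooth on `]0, ∞[`. [folklore] -/
theorem contDiffOn_mul_kA_one : ContDiffOn ℝ (⊤ : ℕ∞) (fun t : ℝ => t * kA 1 t) (Ioi 0) :=
  contDiffOn_id.mul (contDiffOn_kA 1)

omit [FiniteDimensional ℝ E] in
/-- `G ∈ C^∞(Ω)`. [folklore] -/
theorem contDiffOn_coneG (a β η : ℝ) (e : E) : ContDiffOn ℝ (⊤ : ℕ∞) (coneG a β η) (halfDom e) := by
  have hk : ContDiffOn ℝ (⊤ : ℕ∞) (fun y : ℝ × E => y.1 * kA 1 y.1) (halfDom e) :=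
    contDiffOn_mul_kA_one.comp contDiffOn_fst fun z hz => hz.1
  have hN : ContDiffOn ℝ (⊤ : ℕ∞) (radPow (β - 1) : ℝ × E → ℝ) (halfDom e) :=
    (contDiffOn_radPow (β - 1)).mono (halfDom_subset_snd_ne_zero e)
  rw [coneG_eq]
  exact (contDiffOn_const.mul hk).mul hN

/-- **`ΔG = (4aβη t k₁(t)) · 2(β-1)(d + 2β - 6) (‖x‖²)^{β-2}`** on `Ω`. [cite: LiSverak2012, §4] -/
theorem lap_coneG (a β η : ℝ) (e : E) {z : ℝ × E} (hz : z ∈ halfDom e) :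
    lap (coneG a β η) z =
      2 * (β - 1) * ((Module.finrank ℝ E : ℝ) + 2 * (β - 1) - 2) * (4 * a * β * η * (z.1 * kA 1 z.1)) *
        (‖z.2‖ ^ 2) ^ (β - 2) := by
  rw [coneG_eq, lap_sepRad (contDiffOn_const.mul contDiffOn_mul_kA_one) (β - 1) e hz, radPow_apply,
    show β - 1 - 1 = β - 2 by ring]

end ConeWeight

end Carleman

end Literature.Analysis.FluidPDE
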